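import Literature.NumberTheory.LFunctions.FordProgram1Run18A
import Literature.NumberTheory.LFunctions.FordProgram1Run18B
import Literature.NumberTheory.LFunctions.FordProgram1Run18C
import HarnessLib

/-!
# Ford's "Program 1": kernel run 18 (`765 ≤ k ≤ 785`)

Topic `Literature/NumberTheory/LFunctions`. Everything here is PROVED (standard axioms):
`FordP1.checkT k = true` for `765 ≤ k ≤ 785`, i.e. the certified re-run of PROGRAM 1 of
K. Ford, Proc. LMS 85 (2002) (the second part of Theorem 3) for these `k` — see `FordProgram1.lean`
for the checker, its soundness `FordP1.row_of_checkK`, and the meaning of the constants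
(`ρ = FordP1.rhoOf k / 10⁵`, `θ = FordP1.thetaOf k / 10⁴`, `ω = FordP1.omOf k / 10⁴`). The kernel
evaluations themselves (one `decide +kernel` per `k`, so that the kernel's evaluation state is
bounded by a single run — one `decide +kernel` over the whole range exceeds the kernel's memory
bound) are `FordProgram1Run18A.lean` (`765–771`), `FordProgram1Run18B.lean` (`772–778`) and
`FordProgram1Run18C.lean` (`779–785`); this file only recombines them into the `List.all` range
statement `FordP1.run18` used by the assembly `FordTheorem3SmallK.lean`.

## References

* K. Ford, Proc. London Math. Soc. (3) 85 (2002), 565–633; arXiv:1910.08209: Theorem 3, (1.7),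
  Lemmas 3.4–3.5, Appendix "PROGRAM 1". [Ford2002]
-/

namespace Literature.NumberTheory.LFunctions
namespace FordP1

/-- **Kernel run 18**: `checkT k` for `765 ≤ k ≤ 785`. [cite: Ford2002, Theorem 3 (second part)
and PROGRAM 1] -/
theorem run18 : ((List.range' 765 21).all checkT) = true := by
  rw [List.all_eq_true]
  intro k hk
  rw [List.mem_range'_1] at hk
  rcases lt_or_ge k 772 with h | h
  · exact run18A k hk.1 (by omega)
  rcases lt_or_ge k 779 with h' | h'
  · exact run18B k h (by omega)
  · exact run18C k h' (by omega)

end FordP1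
end Literature.NumberTheory.LFunctions
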